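import Literature.Computability.ImplicitComplexity.SoftTypeAssignmentSubst
import HarnessLib

/-!
# De Bruijn substitution algebra for `STA` terms: pointwise companions and the β-substitution

Support file for the `PTIME` characterisation of `STA` (`SoftTypeAssignmentPTIME.lean`, fact
`STACapturesP`, Gaboardi–Marion–Ronchi Della Rocca 2008 = GMR08, Thm. 3.5 + 3.9). The σ-calculus
identities themselves (`rename_rename`, `substp_rename`, `rename_substp`, `substp_substp`,
`substp_var`, `subst0_rename`, `subst0_substp`, …) are in `SoftTypeAssignmentSubst.lean`; this
file adds the small POINTWISE companions that structural inductions over typing derivations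
consume (renamings/substitutions are compared slot by slot there, never as functions):

* `liftRen_zero`, `liftRen_succ`, `liftRen_id_apply`, `liftRen_comp_apply`, `liftRen_congr`;
* `Term.rename_congr`, `Term.rename_id'`, `Term.up_zero`, `Term.up_succ`, `Term.up_congr`;
* the β-substitution `[N/x₀, x₀/x₁, …]` as a named substitution `Term.consSub N`, with
  `subst0_eq_substp : M.subst0 N = M.substp (consSub N)` and the constructor-wise unfolding of
  `subst0`, and sum-freeness of the substitution data (`SumFree.consSub`, `SumFree.subst0`,
  `SumFree.up`).

All statements are folklore identities of de Bruijn's calculus.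

## References

* [GaboardiMarionRonchidellarocca2008] GMR08, Def. 3.1 (ii) (β-reduction and `M[N/x]`).
-/

namespace Literature.Computability.ImplicitComplexity

namespace STA

/-! ### Lifting renamings under a binder, pointwise -/

/-- `liftRen ρ 0 = 0`. [folklore] -/
@[simp] theorem liftRen_zero (ρ : ℕ → ℕ) : liftRen ρ 0 = 0 := rfl

/-- `liftRen ρ (i+1) = ρ i + 1`. [folklore] -/
@[simp] theorem liftRen_succ (ρ : ℕ → ℕ) (i : ℕ) : liftRen ρ (i + 1) = ρ i + 1 := rfl

/-- Lifting the identity renaming is the identity (pointwise). [folklore] -/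
theorem liftRen_id_apply (i : ℕ) : liftRen (fun j => j) i = i := by
  cases i <;> rfl

/-- Lifting commutes with composition of renamings (pointwise). [folklore] -/
theorem liftRen_comp_apply (ρ₁ ρ₂ : ℕ → ℕ) (i : ℕ) :
    liftRen (ρ₂ ∘ ρ₁) i = liftRen ρ₂ (liftRen ρ₁ i) := by
  cases i <;> rfl

/-- Lifting respects pointwise equality. [folklore] -/
theorem liftRen_congr {ρ₁ ρ₂ : ℕ → ℕ} (h : ∀ i, ρ₁ i = ρ₂ i) (i : ℕ) :
    liftRen ρ₁ i = liftRen ρ₂ i := by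
  cases i with
  | zero => rfl
  | succ i => simp [h i]

namespace Term

/-! ### Renaming and lifting, pointwise -/

/-- Renaming respects pointwise equality of renamings. [folklore] -/
theorem rename_congr {ρ₁ ρ₂ : ℕ → ℕ} (h : ∀ i, ρ₁ i = ρ₂ i) (M : Term) :
    M.rename ρ₁ = M.rename ρ₂ := by
  induction M generalizing ρ₁ ρ₂ with
  | var i => simp [Term.rename, h i]
  | app M N ihM ihN => simp [Term.rename, ihM h, ihN h]
  | lam M ih => simp [Term.rename, ih (liftRen_congr h)]
  | sum M N ihM ihN => simp [Term.rename, ihM h, ihN h]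

/-- Renaming by the identity, written as a λ. [folklore] -/
theorem rename_id' (M : Term) : M.rename (fun i => i) = M :=
  Term.rename_id M

/-- `up τ 0 = var 0`. [folklore] -/
@[simp] theorem up_zero (τ : ℕ → Term) : Term.up τ 0 = .var 0 := rfl

/-- `up τ (i+1) = (τ i).rename succ`. [folklore] -/
@[simp] theorem up_succ (τ : ℕ → Term) (i : ℕ) : Term.up τ (i + 1) = (τ i).rename Nat.succ := rfl

/-- `up` respects pointwise equality. [folklore] -/
theorem up_congr {τ₁ τ₂ : ℕ → Term} (h : ∀ i, τ₁ i = τ₂ i) (i : ℕ) : Term.up τ₁ i = Term.up τ₂ i := by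
  cases i with
  | zero => rfl
  | succ i => simp [h i]

/-- Lifting a renaming-qua-substitution (pointwise). [folklore] -/
theorem up_var_comp (ρ : ℕ → ℕ) (i : ℕ) :
    Term.up (fun j => Term.var (ρ j)) i = Term.var (liftRen ρ i) := by
  cases i <;> rfl

/-! ### Single substitution `M[N/x]` (the β-rule) -/

/-- The substitution `[N/x₀, x₀/x₁, x₁/x₂, …]` of the β-rule. [folklore] -/
def consSub (N : Term) : ℕ → Term
  | 0 => N
  | i + 1 => .var i

/-- `consSub N 0 = N`. [folklore] -/
@[simp] theorem consSub_zero (N : Term) : consSub N 0 = N := rfl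

/-- `consSub N (i+1) = var i`. [folklore] -/
@[simp] theorem consSub_succ (N : Term) (i : ℕ) : consSub N (i + 1) = .var i := rfl

/-- `M[N/x]` is parallel substitution by `consSub N`.
[cite: GaboardiMarionRonchidellarocca2008, Def. 3.1 (ii)] -/
theorem subst0_eq_substp (M N : Term) : M.subst0 N = M.substp (consSub N) := by
  unfold Term.subst0
  exact substp_congr (fun i => by cases i <;> rfl) M

/-- `var 0 [N/x₀] = N`. [folklore] -/
@[simp] theorem subst0_var_zero (N : Term) : (Term.var 0).subst0 N = N := rfl

/-- `var (i+1) [N/x₀] = var i`. [folklore] -/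
@[simp] theorem subst0_var_succ (i : ℕ) (N : Term) : (Term.var (i + 1)).subst0 N = .var i := rfl

/-- `(M₁ M₂)[N/x] = M₁[N/x] M₂[N/x]`. [folklore] -/
@[simp] theorem subst0_app (M₁ M₂ N : Term) :
    (Term.app M₁ M₂).subst0 N = .app (M₁.subst0 N) (M₂.subst0 N) := rfl

/-- `(M₁ + M₂)[N/x] = M₁[N/x] + M₂[N/x]`. [folklore] -/
@[simp] theorem subst0_sum (M₁ M₂ N : Term) :
    (Term.sum M₁ M₂).subst0 N = .sum (M₁.subst0 N) (M₂.subst0 N) := rfl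

/-- `(λ M)[N/x] = λ (M[⇑(consSub N)])`. [folklore] -/
theorem subst0_lam (M N : Term) :
    (Term.lam M).subst0 N = .lam (M.substp (Term.up (consSub N))) := by
  rw [subst0_eq_substp]
  rfl

/-! ### Sum-freeness of substitution data -/

/-- `consSub N` is sum-free when `N` is. [folklore] -/
theorem SumFree.consSub {N : Term} (hN : N.SumFree) (i : ℕ) : (consSub N i).SumFree := by
  cases i with
  | zero => exact hN
  | succ i => trivial

/-- `M[N/x]` is sum-free when `M` and `N` are. [folklore] -/
theorem SumFree.subst0 {M N : Term} (hM : M.SumFree) (hN : N.SumFree) : (M.subst0 N).SumFree := by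
  rw [subst0_eq_substp]
  exact hM.substp (SumFree.consSub hN)

/-- `up τ` is pointwise sum-free when `τ` is. [folklore] -/
theorem SumFree.up {τ : ℕ → Term} (hτ : ∀ i, (τ i).SumFree) (i : ℕ) : (Term.up τ i).SumFree := by
  cases i with
  | zero => trivial
  | succ i => exact (hτ i).rename Nat.succ

end Term

end STA

end Literature.Computability.ImplicitComplexity
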